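import Summits.BirchSwinnertonDyer.BirchSwinnertonDyer.Theorems.SylvesterTwoHeegnerIndexUpperOffV0DescentDefectClaimA
import HarnessLib

/-!
# Route `PrintCFram`, crux C2 `BottomClassIndexLawFiveLe` (stmt-BirchSwinnertonDyer-20372), line
# `eisenstein-resource-bdp-line`, stub `stub_kolyvaginUpper_borelCM_pairSum_offKrizLi`:
# **KOLYVAGIN'S DESCENT UNDER THE BOREL ČEBOTAREV AXIOM, I — DATA, DEPTH BOOKKEEPING, CLAIM A** — the
# tree's abstract descent modulo `p^M` (`KolyvaginDescent.HypothesesM`: Claim A, Claim B, annihilation)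
# re-proved with McCallum's Cor. 3.2 REPLACED by the fragment that holds at the CM-ramified (Borel) prime,
# on the visible model; three files (I this one, II `…BorelDescentClaimB`, III `…BorelDescentAnnihilation`)
# (cell `bsd-print-cfram`, seat `bsd-line-cfram-p1-w2` g7; helper `--supports` 20372; 0 defs, 0 facts, 0 sorry)

HONEST FRAMING. Nothing about BSD is proved here and nothing of the stub itself; this is pure algebra.
The tree proves Kolyvagin's descent modulo `p^M` once, for abstract data `KolyvaginDescent.HypothesesM`
(`Literature/…/HeegnerPointsKolyvaginPrimaryDescentProofs`: `claimA` `p^{M₀}·Sel^{−ε} = 0`, `claimB`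
`p^{2M₀}·Sel^{ε} ⊆ ℤx`, `pow_zsmul_mem_zmultiples`). Its field `cebotarev` (McCallum Cor. 3.2: every
independent family of `τ`-eigenclasses acquires ANY prescribed local orders `p^{N_i} ≤ ord` at Kolyvagin
primes) is FALSE on `H¹(K″, W[p^M])` at the Borel CM-ramified prime (w2 g6, `…BorelKolyvaginBlind`:
depth-1 classes of sign `−η_line` are blind) and what survives is w2 g6's FILE 6/7
(`…BorelDepthEigenTargets`, `…BorelVisibleCebotarev`): a class of `𝓞`-depth `e` has order `p^{⌈e/2⌉}`;
classes of sign `η_line` acquire every order `≤ p^{⌈e/2⌉}`, classes of sign `−η_line` every order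
`≤ p^{⌊e/2⌋}` (one short when `e` is odd, nothing when `e = 1`). This file runs the descent on the data
of `HypothesesM` with `cebotarev` replaced by exactly that fragment, on the VISIBLE model (`η_line = ε`,
the sign of the Heegner class), phrased — like `HypothesesM`, with no local cohomology group in the data —
through a depth function `dp` with `p^a v = 0 ↔ dp v ≤ 2a` and three request shapes:

* (B1) `hceb1` — ONE `ε`-class `u`, any exponent `N` with `2N ≤ dp u + 1` (`N ≤ ord`);
* (B2) `hceb2` — an `ε`-class `u` (any `N_u ≤ ord`) jointly with a `(−ε)`-class `w` (`2N_w ≤ dp w`);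
* (B3) `hceb3` — `x ↦ 0` jointly with an `ε`-class `s` TOP-INDEPENDENT of `x` (`N_s ≤ ord`) and a
  `(−ε)`-class `w` (`2N_w ≤ dp w`); plus (B4) `hsplit`: every `ε`-class is `k·x + s′` with `s′`
  top-independent of `x` (an abstract predicate `TopIndep`).

In the application (B1)–(B3) are FILE 7 (`exists_kolyvaginPrime_gt_pow_cebotarevShape_of_cmRamified`, its
`hind` = independent top layers) once top-layer independence is known for the family; the companion note
`Lines/eisenstein-resource-bdp-line-w2g7-notes.md` shows that top layers in DISTINCT (sign, depth-parity)
classes are automatically independent (an `𝓞`-antilinear element of `Γ_{K″}` separates parities, complex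
conjugation separates signs), so (B2) needs no independence at all and (B3) only `x`/`s` decorrelated,
which (B4) supplies by subtracting integer multiples of `x`. Nothing of that instantiation is claimed here.

WHAT IS PROVED IN I–III (all hypotheses explicit; `y := p^{M₀}x = δ_M y_K`, `Ns := (dp s + 1)/2` so
`ord s = p^{Ns}`; THIS FILE = §0 the depth/order dictionary, §1 the data lemmas, §2 Claim A):

* (I, §2) `dp_div_two_le_of_neg_eigen` — **Claim A at the Borel prime**: `⌊dp s/2⌋ ≤ M₀` for `s ∈ Sel^{−ε}`; hence
  `claimA_borel` **`p^{M₀+1}·Sel^{−ε} = 0`** and `claimA_borel_of_even` `p^{M₀} s = 0` when `dp s` is even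
  (the verbatim bound; the lost step is exactly the odd-depth `(−ε)`-classes, the blind ones included).
* (II) `claimB_core` — **one Kolyvagin step WITHOUT Claim A**: for `s ∈ Sel^{ε}` top-independent of `x`, ANY
  Kolyvagin prime `ℓ` and `t ≥ 1` with `ord d(ℓ)_λ ≥ p^t` (`p^{t−1}c(ℓ) ∉ Loc λ`):
  `Ns + ⌊dp c(ℓ)/2⌋ + t ≤ 2M`. The tree's Claim B calls Prop. 10.2 (`p^{M₀}c(ℓ′) = 0`, i.e. Claim A for
  `c(ℓ′)`); here that call is replaced by local duality of the Selmer class `c(ℓ′)` against `d(ℓ)` AT `λ`,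
  which gives `p^{M−t}c(ℓ′)_λ = 0` — all that is needed to make `p^{M−t}c(ℓℓ′)` Selmer off `λ′`. So the
  `(−ε)`-side losses of Claim A never enter Claim B.
* (II) `claimB_indep_borel` **`p^{2M₀+1} s = 0`** (`t = M − M₀` from a step-A prime; the one lost step is the
  prescribed order of the `(−ε)`-class `c(ℓ)` when its depth is odd) and `claimB_indep_borel_of_even`
  **`p^{2M₀} s = 0`** — the VERBATIM bound — as soon as ONE step-A prime `ℓ` (`ord d(ℓ)_λ = p^{M−M₀}`)
  carries a class `c(ℓ)` of EVEN depth; `claimB_borel`, `claimB_borel_of_even` (split off `x` by (B4)).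
* (III) `pow_zsmul_mem_zmultiples_borel` — **annihilation `p^{2M₀+1}·Sel ⊆ ℤx`**; `…_of_even` for the `ε`-part.
* (III) `finite_sha_primary_of_forall_pow_zsmul_mem_zmultiples` — generic passage to `Ш`: annihilation
  `p^C·Sel^{(p^j)}(E/K) ⊆ ℤx_j` at every level with `x_j ∈ δ(E(K))` gives `p^C·Ш(E/K)[p^∞] = 0`, finite
  (the tree's `finite_sha_primary_of_hypothesesM` with the descent data abstracted away).

READING. The verbatim machine survives at the Borel CM-ramified prime with exponent `2M₀ + 1`, and the
ENTIRE residual of sharpness in Claim B is one parity: the `𝓞`-depth of the step-A class `c(ℓ)`, i.e. the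
`𝔭`-adic divisibility of the derived Heegner point `D_ℓ y_ℓ` (notes §3). THEOREMS ONLY; no definition, no
named fact, no `sorry`. BSD is not proved by any of this; no summit statement is proved by this seat.
References: [McCallumLMS1991] §§3–5 (Cor. 3.2, Lemma 4.3, Prop. 4.4, Lemma 5.3, Thm. 5.4);
[GrossLMS1991] §10 (Claims 10.1, 10.3, Prop. 10.2); [SilvermanAEC2009] Thm. X.4.2.
-/

set_option autoImplicit false
-- `…BirchSwinnertonDyer.BirchSwinnertonDyer.Theorems…` is the problem's mandated namespace (D-0017).
set_option linter.dupNamespace false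

noncomputable section

open scoped Classical

universe u

namespace Summit.BirchSwinnertonDyer.BirchSwinnertonDyer.Theorems.PrintCFram.BorelDescent

open WeierstrassCurve Literature.NumberTheory.EllipticCurves
  Literature.NumberTheory.EllipticCurves.KolyvaginDescent
  Summit.BirchSwinnertonDyer.BirchSwinnertonDyer.Theorems.SylvesterTwoUpper.DescentDefect

/-! ## §0 Depth ↔ order bookkeeping (`p^a v = 0 ↔ dp v ≤ 2a`, i.e. `ord v = p^{⌈dp v/2⌉}`) -/

section Depth

variable {V : Type*} [AddCommGroup V] {p M : ℕ} {dp : V → ℕ}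

/-- `p^{⌈dp v/2⌉} v = 0`. [folklore] -/
theorem pow_half_succ_zsmul_eq_zero
    (hdp : ∀ (v : V) (a : ℕ), ((p : ℤ) ^ a) • v = 0 ↔ dp v ≤ 2 * a) (v : V) :
    ((p : ℤ) ^ ((dp v + 1) / 2)) • v = 0 :=
  (hdp v _).2 (by omega)

/-- `p^{⌈dp v/2⌉ − 1} v ≠ 0` for `v ≠ 0`: the order of `v` is EXACTLY `p^{⌈dp v/2⌉}`. [folklore] -/
theorem pow_half_succ_sub_one_zsmul_ne_zero
    (hdp : ∀ (v : V) (a : ℕ), ((p : ℤ) ^ a) • v = 0 ↔ dp v ≤ 2 * a) {v : V} (hv : dp v ≠ 0) :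
    ((p : ℤ) ^ ((dp v + 1) / 2 - 1)) • v ≠ 0 := fun h ↦ by
  have := (hdp v _).1 h
  omega

/-- `v = 0 ↔ dp v = 0`. [folklore] -/
theorem eq_zero_iff_dp_eq_zero
    (hdp : ∀ (v : V) (a : ℕ), ((p : ℤ) ^ a) • v = 0 ↔ dp v ≤ 2 * a) (v : V) : v = 0 ↔ dp v = 0 := by
  have h := hdp v 0
  rw [pow_zero, one_smul, mul_zero, Nat.le_zero] at h
  exact h

/-- In a group killed by `p^M` every depth is `≤ 2M`. [folklore] -/
theorem dp_le_two_mul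
    (hdp : ∀ (v : V) (a : ℕ), ((p : ℤ) ^ a) • v = 0 ↔ dp v ≤ 2 * a)
    (htor : ∀ v : V, ((p : ℤ) ^ M) • v = 0) (v : V) : dp v ≤ 2 * M :=
  (hdp v M).1 (htor v)

/-- `p^a v ≠ 0` forces `2a + 1 ≤ dp v`. [folklore] -/
theorem two_mul_succ_le_dp_of_ne_zero
    (hdp : ∀ (v : V) (a : ℕ), ((p : ℤ) ^ a) • v = 0 ↔ dp v ≤ 2 * a) {v : V} {a : ℕ}
    (hv : ((p : ℤ) ^ a) • v ≠ 0) : 2 * a + 1 ≤ dp v := by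
  by_contra h
  exact hv ((hdp v a).2 (by omega))

end Depth

/-! ## §1 The common data: the Heegner class `y = p^{M₀} x`, Kolyvagin's classes

The sign and eigenclass bookkeeping of the displayed data (`neg_sign`, `sign_mul_self`, `τ_y`, `τ_c_prime`,
`τ_c_mul`, `c_mem_loc_of_ne`, `c_mem_loc_iff_one`) is REUSED from the tree's parity-free twin of `HypothesesM`
(`…SylvesterTwoHeegnerIndexUpperOffV0DescentDefectClaimA`, namespace `…SylvesterTwoUpper.DescentDefect`),
which displays the same fields with the same shapes. -/

section Data

variable {V : Type*} [AddCommGroup V] {Pl : Type*}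
variable {p M M₀ : ℕ} {ε : ℤ} {τ : V →+ V} {Sel : AddSubgroup V} {Loc : Pl → AddSubgroup V}
  {Kol : ℕ → Prop} {pl : ℕ → Pl} {Dv : Pl → ℕ → Prop} {A : ℕ → AddSubgroup V} {x : V} {c : ℕ → V}

/-- `ord y = p^{M − M₀}`: `p^{M−M₀−1} y = p^{M−1} x ≠ 0` when `M₀ < M`.
[cite: McCallumLMS1991, Lemma 5.1] -/
theorem pow_zsmul_y_ne_zero (hxord : ((p : ℤ) ^ (M - 1)) • x ≠ 0) (hM₀ : M₀ < M) :
    ((p : ℤ) ^ (M - M₀ - 1)) • (((p : ℤ) ^ M₀) • x) ≠ 0 := by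
  rw [smul_smul, ← pow_add, show M - M₀ - 1 + M₀ = M - 1 by omega]
  exact hxord

/-- `y ≠ 0` when `M₀ < M`. [folklore] -/
theorem y_ne_zero (hxord : ((p : ℤ) ^ (M - 1)) • x ≠ 0) (hM₀ : M₀ < M) :
    ((p : ℤ) ^ M₀) • x ≠ 0 := fun h ↦
  pow_zsmul_y_ne_zero (p := p) hxord hM₀ (by rw [h, smul_zero])

/-- A Kolyvagin class `c(ℓ′)` with `x_{λ′} = 0` is a Selmer class (then `y_{λ′} = 0`, so
`d(ℓ′)_{λ′} = 0` by Prop. 4.4, and Lemma 4.3 elsewhere). [cite: GrossLMS1991, Prop. 10.2] -/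
theorem c_mem_sel_of_x_mem (hKol : ∀ ℓ, Kol ℓ → ℓ.Prime)
    (hSel : ∀ s, s ∈ Sel ↔ ∀ v, s ∈ Loc v) (hdv : ∀ ℓ, Kol ℓ → ∀ v, Dv v ℓ ↔ v = pl ℓ)
    (hc1 : c 1 = ((p : ℤ) ^ M₀) • x)
    (hcloc : ∀ n, KolSupp Kol n → ∀ v, ¬ Dv v n → c n ∈ Loc v)
    (hc44 : ∀ ℓ m, Kol ℓ → KolSupp Kol (ℓ * m) → ∀ a : ℕ,
      (((p : ℤ) ^ a) • c (ℓ * m) ∈ Loc (pl ℓ)) ↔ ((p : ℤ) ^ a) • c m ∈ A ℓ)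
    {ℓ : ℕ} (hℓ : Kol ℓ) (hx : x ∈ A ℓ) : c ℓ ∈ Sel := by
  refine (hSel _).2 fun v ↦ ?_
  by_cases hv : v = pl ℓ
  · rw [hv]
    have h0 : ((p : ℤ) ^ 0) • (((p : ℤ) ^ M₀) • x) ∈ A ℓ := by
      rw [pow_zero, one_smul]
      exact (A ℓ).zsmul_mem hx _
    have := (c_mem_loc_iff_one (Loc := Loc) hKol hc1 hc44 hℓ 0).2 h0
    rwa [pow_zero, one_smul] at this
  · exact c_mem_loc_of_ne hKol hdv hcloc hℓ hv

end Data

/-! ## §2 Claim A at the Borel prime: `⌊dp s/2⌋ ≤ M₀` on `Sel^{−ε}`, so `p^{M₀+1}·Sel^{−ε} = 0` -/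

section ClaimA

variable {V : Type*} [AddCommGroup V] {Pl : Type*}
variable {p M M₀ : ℕ} {ε : ℤ} {τ : V →+ V} {Sel : AddSubgroup V} {Loc : Pl → AddSubgroup V}
  {Kol : ℕ → Prop} {pl : ℕ → Pl} {Dv : Pl → ℕ → Prop} {A : ℕ → AddSubgroup V} {x : V} {c : ℕ → V}
  {dp : V → ℕ}

/-- **Claim A at the Borel prime (core): `⌊dp s/2⌋ ≤ M₀` for every `s ∈ Sel^{−ε}`.** McCallum's
argument verbatim except for the request made of Čebotarev: the pair shape (B2) gives a Kolyvagin
prime `ℓ` with `ord y_λ = p^{M−M₀}` (the `ε`-class `y`, full order) and `ord s_λ = p^{⌊dp s/2⌋}` (the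
`(−ε)`-class `s`, one short of `ord s` when `dp s` is odd); Prop. 4.4 makes `d(ℓ)` — a `(−ε)`-class
Selmer off `λ` — of local order `p^{M−M₀}`, and local duality with reciprocity (Lemma 5.3, Prop. 2.2)
forces `ord s_λ ≤ p^{M₀}`. [cite: GrossLMS1991, §10 Claim 10.1] [cite: McCallumLMS1991, §5] -/
theorem dp_div_two_le_of_neg_eigen (hε : ε = 1 ∨ ε = -1)
    (htor : ∀ v : V, ((p : ℤ) ^ M) • v = 0)
    (hKol : ∀ ℓ, Kol ℓ → ℓ.Prime) (hdv : ∀ ℓ, Kol ℓ → ∀ v, Dv v ℓ ↔ v = pl ℓ)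
    (hxord : ((p : ℤ) ^ (M - 1)) • x ≠ 0) (hτx : τ x = ε • x)
    (hc1 : c 1 = ((p : ℤ) ^ M₀) • x)
    (hτc : ∀ n, KolSupp Kol n → τ (c n) = (ε * (-1) ^ n.primeFactors.card) • c n)
    (hcloc : ∀ n, KolSupp Kol n → ∀ v, ¬ Dv v n → c n ∈ Loc v)
    (hc44 : ∀ ℓ m, Kol ℓ → KolSupp Kol (ℓ * m) → ∀ a : ℕ,
      (((p : ℤ) ^ a) • c (ℓ * m) ∈ Loc (pl ℓ)) ↔ ((p : ℤ) ^ a) • c m ∈ A ℓ)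
    (hdual : ∀ ℓ, Kol ℓ → ∀ ν : ℤ, (ν = 1 ∨ ν = -1) → ∀ d, τ d = ν • d →
      (∀ v, v ≠ pl ℓ → d ∈ Loc v) → ∀ s ∈ Sel, τ s = ν • s →
      ∀ a, a < M → ((p : ℤ) ^ a) • d ∉ Loc (pl ℓ) → ((p : ℤ) ^ (M - 1 - a)) • s ∈ A ℓ)
    (hdp : ∀ (v : V) (a : ℕ), ((p : ℤ) ^ a) • v = 0 ↔ dp v ≤ 2 * a)
    (hceb2 : ∀ (u w : V) (Nu Nw : ℕ), u ≠ 0 → w ≠ 0 → τ u = ε • u → τ w = (-ε) • w →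
      2 * Nu ≤ dp u + 1 → 2 * Nw ≤ dp w → ∀ b : ℕ, ∃ ℓ, b < ℓ ∧ Kol ℓ ∧
        (((p : ℤ) ^ Nu) • u ∈ A ℓ ∧ (Nu ≠ 0 → ((p : ℤ) ^ (Nu - 1)) • u ∉ A ℓ)) ∧
        (((p : ℤ) ^ Nw) • w ∈ A ℓ ∧ (Nw ≠ 0 → ((p : ℤ) ^ (Nw - 1)) • w ∉ A ℓ)))
    {s : V} (hs : s ∈ Sel) (hτs : τ s = (-ε) • s) : dp s / 2 ≤ M₀ := by
  rcases Nat.lt_or_ge M₀ M with hM₀ | hM₀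
  swap
  · have := dp_le_two_mul hdp htor s
    omega
  by_cases hN : dp s / 2 = 0
  · omega
  have hs0 : s ≠ 0 := by
    rw [Ne, eq_zero_iff_dp_eq_zero hdp]
    omega
  have hy0 : ((p : ℤ) ^ M₀) • x ≠ 0 := y_ne_zero hxord hM₀
  have hydp : 2 * (M - M₀) ≤ dp (((p : ℤ) ^ M₀) • x) + 1 := by
    have := two_mul_succ_le_dp_of_ne_zero hdp (pow_zsmul_y_ne_zero hxord hM₀)
    omega
  -- Čebotarev, pair shape: `ord y_λ = p^{M−M₀}`, `ord s_λ = p^{⌊dp s/2⌋}`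
  obtain ⟨ℓ, -, hℓ, ⟨-, hyA⟩, ⟨-, hsA⟩⟩ := hceb2 (((p : ℤ) ^ M₀) • x) s (M - M₀) (dp s / 2) hy0 hs0
    (τ_y hτx) hτs hydp (Nat.mul_div_le (dp s) 2) 0
  have hyA' := hyA (by omega)
  have hsA' := hsA hN
  -- `d(ℓ)` has local order `p^{M−M₀}` at `λ`, is Selmer off `λ`, of sign `−ε`
  have h1 : ((p : ℤ) ^ (M - M₀ - 1)) • c ℓ ∉ Loc (pl ℓ) := fun h ↦
    hyA' ((c_mem_loc_iff_one hKol hc1 hc44 hℓ _).1 h)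
  have hdu := hdual ℓ hℓ (-ε) (neg_sign hε) (c ℓ) (τ_c_prime hKol hτc hℓ)
    (fun v hv ↦ c_mem_loc_of_ne hKol hdv hcloc hℓ hv) s hs hτs (M - M₀ - 1) (by omega) h1
  rw [show M - 1 - (M - M₀ - 1) = M₀ by omega] at hdu
  -- hence `⌊dp s/2⌋ − 1 < M₀`
  by_contra hlt
  exact hsA' (pow_zsmul_mem_of_le (show M₀ ≤ dp s / 2 - 1 by omega) hdu)

/-- **Claim A at the Borel prime: `p^{M₀+1}·Sel^{−ε} = 0`** (from `⌊dp s/2⌋ ≤ M₀`: `dp s ≤ 2M₀ + 1`,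
so `ord s = p^{⌈dp s/2⌉} ≤ p^{M₀+1}`). One `p`-step weaker than McCallum's `p^{M₀}`; the step is lost only
on `(−ε)`-classes of odd depth. [cite: GrossLMS1991, §10 Claim 10.1] [cite: McCallumLMS1991, §5] -/
theorem claimA_borel (hε : ε = 1 ∨ ε = -1)
    (htor : ∀ v : V, ((p : ℤ) ^ M) • v = 0)
    (hKol : ∀ ℓ, Kol ℓ → ℓ.Prime) (hdv : ∀ ℓ, Kol ℓ → ∀ v, Dv v ℓ ↔ v = pl ℓ)
    (hxord : ((p : ℤ) ^ (M - 1)) • x ≠ 0) (hτx : τ x = ε • x)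
    (hc1 : c 1 = ((p : ℤ) ^ M₀) • x)
    (hτc : ∀ n, KolSupp Kol n → τ (c n) = (ε * (-1) ^ n.primeFactors.card) • c n)
    (hcloc : ∀ n, KolSupp Kol n → ∀ v, ¬ Dv v n → c n ∈ Loc v)
    (hc44 : ∀ ℓ m, Kol ℓ → KolSupp Kol (ℓ * m) → ∀ a : ℕ,
      (((p : ℤ) ^ a) • c (ℓ * m) ∈ Loc (pl ℓ)) ↔ ((p : ℤ) ^ a) • c m ∈ A ℓ)
    (hdual : ∀ ℓ, Kol ℓ → ∀ ν : ℤ, (ν = 1 ∨ ν = -1) → ∀ d, τ d = ν • d →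
      (∀ v, v ≠ pl ℓ → d ∈ Loc v) → ∀ s ∈ Sel, τ s = ν • s →
      ∀ a, a < M → ((p : ℤ) ^ a) • d ∉ Loc (pl ℓ) → ((p : ℤ) ^ (M - 1 - a)) • s ∈ A ℓ)
    (hdp : ∀ (v : V) (a : ℕ), ((p : ℤ) ^ a) • v = 0 ↔ dp v ≤ 2 * a)
    (hceb2 : ∀ (u w : V) (Nu Nw : ℕ), u ≠ 0 → w ≠ 0 → τ u = ε • u → τ w = (-ε) • w →
      2 * Nu ≤ dp u + 1 → 2 * Nw ≤ dp w → ∀ b : ℕ, ∃ ℓ, b < ℓ ∧ Kol ℓ ∧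
        (((p : ℤ) ^ Nu) • u ∈ A ℓ ∧ (Nu ≠ 0 → ((p : ℤ) ^ (Nu - 1)) • u ∉ A ℓ)) ∧
        (((p : ℤ) ^ Nw) • w ∈ A ℓ ∧ (Nw ≠ 0 → ((p : ℤ) ^ (Nw - 1)) • w ∉ A ℓ)))
    {s : V} (hs : s ∈ Sel) (hτs : τ s = (-ε) • s) : ((p : ℤ) ^ (M₀ + 1)) • s = 0 :=
  (hdp s _).2 (by
    have := dp_div_two_le_of_neg_eigen hε htor hKol hdv hxord hτx hc1 hτc hcloc hc44 hdual hdp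
      hceb2 hs hτs
    omega)

/-- **The verbatim Claim A on even-depth classes: `p^{M₀} s = 0`** for `s ∈ Sel^{−ε}` with `dp s`
even (then `ord s = p^{dp s/2} ≤ p^{M₀}`). [cite: GrossLMS1991, §10 Claim 10.1] -/
theorem claimA_borel_of_even (hε : ε = 1 ∨ ε = -1)
    (htor : ∀ v : V, ((p : ℤ) ^ M) • v = 0)
    (hKol : ∀ ℓ, Kol ℓ → ℓ.Prime) (hdv : ∀ ℓ, Kol ℓ → ∀ v, Dv v ℓ ↔ v = pl ℓ)
    (hxord : ((p : ℤ) ^ (M - 1)) • x ≠ 0) (hτx : τ x = ε • x)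
    (hc1 : c 1 = ((p : ℤ) ^ M₀) • x)
    (hτc : ∀ n, KolSupp Kol n → τ (c n) = (ε * (-1) ^ n.primeFactors.card) • c n)
    (hcloc : ∀ n, KolSupp Kol n → ∀ v, ¬ Dv v n → c n ∈ Loc v)
    (hc44 : ∀ ℓ m, Kol ℓ → KolSupp Kol (ℓ * m) → ∀ a : ℕ,
      (((p : ℤ) ^ a) • c (ℓ * m) ∈ Loc (pl ℓ)) ↔ ((p : ℤ) ^ a) • c m ∈ A ℓ)
    (hdual : ∀ ℓ, Kol ℓ → ∀ ν : ℤ, (ν = 1 ∨ ν = -1) → ∀ d, τ d = ν • d →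
      (∀ v, v ≠ pl ℓ → d ∈ Loc v) → ∀ s ∈ Sel, τ s = ν • s →
      ∀ a, a < M → ((p : ℤ) ^ a) • d ∉ Loc (pl ℓ) → ((p : ℤ) ^ (M - 1 - a)) • s ∈ A ℓ)
    (hdp : ∀ (v : V) (a : ℕ), ((p : ℤ) ^ a) • v = 0 ↔ dp v ≤ 2 * a)
    (hceb2 : ∀ (u w : V) (Nu Nw : ℕ), u ≠ 0 → w ≠ 0 → τ u = ε • u → τ w = (-ε) • w →
      2 * Nu ≤ dp u + 1 → 2 * Nw ≤ dp w → ∀ b : ℕ, ∃ ℓ, b < ℓ ∧ Kol ℓ ∧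
        (((p : ℤ) ^ Nu) • u ∈ A ℓ ∧ (Nu ≠ 0 → ((p : ℤ) ^ (Nu - 1)) • u ∉ A ℓ)) ∧
        (((p : ℤ) ^ Nw) • w ∈ A ℓ ∧ (Nw ≠ 0 → ((p : ℤ) ^ (Nw - 1)) • w ∉ A ℓ)))
    {s : V} (hs : s ∈ Sel) (hτs : τ s = (-ε) • s) (heven : Even (dp s)) :
    ((p : ℤ) ^ M₀) • s = 0 :=
  (hdp s _).2 (by
    obtain ⟨k, hk⟩ := heven
    have := dp_div_two_le_of_neg_eigen hε htor hKol hdv hxord hτx hc1 hτc hcloc hc44 hdual hdp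
      hceb2 hs hτs
    omega)

end ClaimA

end Summit.BirchSwinnertonDyer.BirchSwinnertonDyer.Theorems.PrintCFram.BorelDescent

end
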